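import Summits.Langlands.Langlands.Theses.OrdinaryPrimeTransport
import Literature.NumberTheory.GaloisRepresentations.CalegariEvenFontaineMazurTwo
import Literature.NumberTheory.Automorphic.Qian2022PotentialAutomorphy
import HarnessLib

/-!
# Line `ScalarSignRegularGL3` — ladder-down rung (generation 22) on crux `ReciprocityUpToIrreducibility`
# (item stmt-Langlands-14328; routes IrreducibilityBySelfDuality, OrdinaryPrimeTransport)

This PUBLISHED tree copy concludes the `OrdinaryPrimeTransport` decl of the SHARED item stmt-Langlands-14328 (same
text as the `IrreducibilityBySelfDuality` decl, `Iff.rfl` — the g3–g21 convention, forced by farm coherence of that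
module); the seat-folder copy `Sketch.lean` concludes the `IrreducibilityBySelfDuality` decl BY NAME (rc 0, 5 sorries).

DIAL = the rank `n` of the SCALAR-SIGN REGULAR sector of clause (B) of E over totally real fields:
`ρ : Γ_F → GL_n(ℚ̄_p)` irreducible, a.e. unramified, de Rham with distinct labelled Hodge–Tate weights
above `p` (`F` totally real, `p > 7` split completely in `F`), residually non-degenerate, and every
complex conjugation acting through the CENTRE: `ρ(c) = 1` or `ρ(c) = -1`.  Conjecturally (Fontaine–Mazur
+ Langlands + Clozel's purity/parity, Caraiani–Le Hung) the sector is EMPTY for `n ≥ 2`; the family is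
typed in (B)-form ("… is cuspidal automorphic, `Corresponds` for every `Rec`") so that the summit gives
every rung by restriction (`_onpath`), and a rung is PROVED by showing its hypotheses contradictory.

* floor `n = 2`: Calegari 2011/2012 Thm. 1.2 (tree named fact `Calegari2011_thm_1_2`): such `ρ` are odd,
  and in rank two "scalar sign" is "even" (`FramedGaloisRep.isEven_iff_eq_one_or_eq_neg_one`).
* RUNG `n = 3` (this line): no irreducible regular geometric `ρ : Γ_F → GL₃(ℚ̄_p)` on which complex
  conjugation is central.
* located stop: Calegari's engine = self-dual shadow `Sym² ρ` + odd-polarised potential automorphy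
  (BLGGT) + the sign theorem for RAESDC representations (Taylor 2012).  A generic rank-3 `ρ` has NO
  Hodge–Tate-regular self-dual polynomial shadow (every self-dual irreducible representation of `SL₃`
  has a weight of multiplicity ≥ 2 — (B1) below), so the engine has no purchase; the
  ORDINARY cell is decided in print by the non-polarisable route (Qian 2022 Thm. 1.4 → Arthur–Clozel
  descent → HLTT → Caraiani–Le Hung 2016 Thm. 1: `tr ρ(c) = ±1 ≠ ±3`); the NON-ORDINARY non-polarisable
  cell is the open core: Qian's `F′/F` is produced by Moret-Bailly with NO control of the ramification of
  `p` (Thm. 1.1 as printed; the local condition at `v ∣ p` is met by trivialising `ρ̄|Γ_{F_v}`), so over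
  `F′` only the ORDINARY lifting theorem ACC⁺ 6.1.2 applies — the Fontaine–Laffaille theorem ACC⁺ 6.1.1
  (tree fact `ACCGHLNSTT2023.automorphyLifting_crystalline_weightZero`) needs `p` unramified in `F′` —
  and the family method itself only reaches consecutive weights (`Literature.Barriers.Langlands.
  FamilyWitnessConsecutiveWeights`).  Source of (B1): Fulton–Harris, Claim 13.4 (multiplicities of
  `Γ_{a,b}` increase by one on concentric hexagons: `Γ_{a,a}`, `a ≥ 1`, has the weight `0` with
  multiplicity `a + 1 ≥ 2`).
-/

noncomputable section

set_option linter.dupNamespace false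

open scoped MatrixGroups Matrix NumberField Classical
open Filter IsDedekindDomain Field
open Literature.NumberTheory.Automorphic Literature.NumberTheory.GaloisRepresentations
open Literature.NumberTheory.PAdicHodge
open Summit.Langlands

namespace Summit.Langlands.Langlands.Cruxes.ReciprocityUpToIrreducibility.ScalarSignRegularGL3

/-! ## 1. The rung family (dial = rank `n`) -/

/-- **Residual non-degeneracy at rank `n`** — the rank-`n` reading of Calegari's hypotheses (2)–(3).
At `n = 2` VERBATIM Calegari 2011 Thm. 1.2 (2) `Sym² ρ̄|Γ_{F(ζ_p)}` absolutely irreducible and (3) for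
`v ∣ p`, `ρ̄|D_v` is not a twist of `(ε̄ * ; 0 1)`; at every other rank: `ρ` has a residual representation
`ρ̄` (ACC⁺ §1) with `ρ̄|Γ_{F(ζ_p)}` absolutely irreducible (the Taylor–Wiles non-degeneracy of ACC⁺ Thm.
6.1.1–6.1.2 / Qian 2022 Thm. 1.4, minus "enormous"/"decomposed generic", which the cells carry).
[cite: Calegari2011, Thm. 1.2] [cite: ACCGHLNSTT2023, Thm. 6.1.1] -/
def ResidualNondegenerate (F : Type) [Field F] [NumberField F] (p : ℕ) [Fact p.Prime] :
    (n : ℕ) → FramedGaloisRep F (PadicAlgCl p) n → Prop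
  | 2, ρ =>
      IsAbsIrreducible
        ((Matrix.GeneralLinearGroup.symSq.comp ρ.residualRep).comp
          (modPCyclotomicCharacterZMod F p).ker.subtype) ∧
      ∀ (v : HeightOneSpectrum (𝓞 F)), ((p : ℕ) : 𝓞 F) ∈ v.asIdeal →
        ¬ IsTwistOfExtOneBy
            (ρ.residualRep.comp (absGaloisRestrict F (v.adicCompletion F)).toMonoidHom)
            (fun g => zmodToPadicAlgClResidueField p ((modPCyclotomicCharacterZMod F p
              (absGaloisRestrict F (v.adicCompletion F) g) : (ZMod p)ˣ) : ZMod p))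
  | _, ρ =>
      ∃ τ : absoluteGaloisGroup F →* GL (Fin _) (padicAlgClResidueField p),
        ρ.IsResidualRepOf (RingHom.id _) τ ∧
          IsAbsIrreducible (τ.comp (absGaloisGroupAdjoinRootsOfUnity F p).subtype)

/-- **The rung family** `ScalarSignRegularReciprocity n`: clause (B) of E, for EVERY reciprocity datum,
on the scalar-sign regular sector of rank `n` over totally real fields (`p > 7` split completely in `F`,
`ρ` irreducible, a.e. unramified, de Rham with multiplicity-free labelled Hodge–Tate weights at every
`v ∣ p` for the pinned Fontaine datum, residually non-degenerate, `ρ(c) ∈ {1, -1}` for every complex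
conjugation `c`).  Conjecturally vacuous for `n ≥ 2`; at `n = 2` it follows from Calegari's theorem
(`floor_two`). -/
def ScalarSignRegularReciprocity (n : ℕ) : Prop :=
  ∀ (F : Type) [Field F] [NumberField F], NumberField.IsTotallyReal F →
  ∀ (p : ℕ) [Fact p.Prime], 7 < p → SplitsCompletely F p →
  ∀ (ρ : FramedGaloisRep F (PadicAlgCl p) n),
    ρ.toGaloisRep.IsIrreducible →
    (∀ᶠ v : HeightOneSpectrum (𝓞 F) in cofinite, ρ.IsUnramifiedAt v) →
    (∀ (v : HeightOneSpectrum (𝓞 F)) (hv : ((p : ℕ) : 𝓞 F) ∈ v.asIdeal),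
      (fontainePstAdicCompletion v p hv).IsDeRhamFramed (ρ.toLocal v) ∧
        ∀ τ : v.adicCompletion F →+* PadicAlgCl p, Continuous τ →
          (ρ.labelledHodgeTateWeightsAt v (fontainePstAdicCompletion v p hv).algebra
            (fontainePstAdicCompletion v p hv).𝔅 τ).Nodup) →
    ResidualNondegenerate F p n ρ →
    (∀ (φ : F →+* ℝ) (c : absoluteGaloisGroup F), IsComplexConjugation φ c → ρ c = 1 ∨ ρ c = -1) →
    ∀ (Rec : ReciprocityData F) (hcpt : isCompact_glFiniteIntegralLevel n F) (ι : PadicAlgCl p ≃+* ℂ),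
      ∃ π : CuspidalAutomorphicRepData n F hcpt, π.1.IsLAlgebraic ∧ Corresponds Rec ι π.1 ρ

/-- **THE RUNG** (the filed statement): the family at `n = 3`. -/
def ScalarSignRegularGL3 : Prop := ScalarSignRegularReciprocity 3

/-! ## 2. The floor `n = 2` (Calegari 2011 Thm. 1.2) and the on-path lemmas -/

/-- **The floor of the ladder**: the family at `n = 2` from the tree named fact `Calegari2011_thm_1_2`:
`ρ` is odd by the fact, even by the scalar-sign clause (`isEven_iff_eq_one_or_eq_neg_one`), and a totally
real field has a real embedding — contradiction (`Calegari2011_thm_1_2.not_isEven`).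
[cite: Calegari2011, Thm. 1.2 (p. 3 of arXiv:1012.4819)] -/
theorem floor_two (h : Calegari2011_thm_1_2) : ScalarSignRegularReciprocity 2 := by
  intro F _ _ hF p _ hp hsplit ρ _hirr hur hpst hres hsign Rec hcpt ι
  exfalso
  haveI := hF
  obtain ⟨w⟩ := (inferInstance : Nonempty (NumberField.InfinitePlace F))
  exact Calegari2011_thm_1_2.not_isEven h F hF
    (NumberField.InfinitePlace.embedding_of_isReal (NumberField.IsTotallyReal.isReal w)) p hp hsplit ρ
    hur hpst hres.1 hres.2 ((FramedGaloisRep.isEven_iff_eq_one_or_eq_neg_one two_ne_zero ρ).mpr hsign)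

/-- **Dial monotonicity in the summit direction**: the summit gives every rung of the family (clause (B)
of `Langlands F` at the given `Rec`; the sector's de Rham clause is stated against the PINNED Fontaine
datum `fontainePstAdicCompletion v p hv = Rec.pst p v hv`, so the hypotheses give `IsGeometricFramed Rec ρ`).
`E → family` is NOT claimed: E provides ONE reciprocity datum per field, the family serves all of them
(it is the summit's clause (B) verbatim on the sector); the line composes `family → E` instead (§5). -/
theorem scalarSignRegularReciprocity_of_langlands (n : ℕ) (hn : 0 < n) (hL : _root_.Langlands) :
    ScalarSignRegularReciprocity n := by
  intro F _ _ _hF p _ _hp _hsplit ρ hirr hur hpst _hres _hsign Rec hcpt ι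
  have hB : GaloisToAutomorphic n Rec hcpt := ((hL F).2 Rec n hn hcpt).2
  exact hB p ι ρ hirr ⟨hur, fun v hv => (hpst v hv).1⟩

/-- **F4 on-path lemma for the rung**: `Langlands → ScalarSignRegularGL3`. -/
@[aesop safe apply]
theorem ScalarSignRegularGL3_of_Langlands (hL : _root_.Langlands) : ScalarSignRegularGL3 :=
  scalarSignRegularReciprocity_of_langlands 3 (by norm_num) hL

/-! ## 3. The sector, bundled; the two cells of the rung; the further rungs; the complement -/

/-- **The hypotheses of the family at `(F, p, ρ)`, bundled**: `F` totally real, `7 < p`, `p` split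
completely in `F`, `ρ` irreducible, a.e. unramified, de Rham with multiplicity-free labelled Hodge–Tate
weights above `p` (pinned Fontaine datum), residually non-degenerate, scalar sign. -/
def InSector {n : ℕ} (F : Type) [Field F] [NumberField F] (p : ℕ) [Fact p.Prime]
    (ρ : FramedGaloisRep F (PadicAlgCl p) n) : Prop :=
  NumberField.IsTotallyReal F ∧ 7 < p ∧ SplitsCompletely F p ∧ ρ.toGaloisRep.IsIrreducible ∧
    (∀ᶠ v : HeightOneSpectrum (𝓞 F) in cofinite, ρ.IsUnramifiedAt v) ∧
    (∀ (v : HeightOneSpectrum (𝓞 F)) (hv : ((p : ℕ) : 𝓞 F) ∈ v.asIdeal),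
      (fontainePstAdicCompletion v p hv).IsDeRhamFramed (ρ.toLocal v) ∧
        ∀ τ : v.adicCompletion F →+* PadicAlgCl p, Continuous τ →
          (ρ.labelledHodgeTateWeightsAt v (fontainePstAdicCompletion v p hv).algebra
            (fontainePstAdicCompletion v p hv).𝔅 τ).Nodup) ∧
    ResidualNondegenerate F p n ρ ∧
    (∀ (φ : F →+* ℝ) (c : absoluteGaloisGroup F), IsComplexConjugation φ c → ρ c = 1 ∨ ρ c = -1)

/-- The family, uncurried through `InSector`. -/
theorem scalarSignRegularReciprocity_iff (n : ℕ) :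
    ScalarSignRegularReciprocity n ↔
      ∀ (F : Type) [Field F] [NumberField F] (p : ℕ) [Fact p.Prime]
        (ρ : FramedGaloisRep F (PadicAlgCl p) n), InSector F p ρ →
        ∀ (Rec : ReciprocityData F) (hcpt : isCompact_glFiniteIntegralLevel n F) (ι : PadicAlgCl p ≃+* ℂ),
          ∃ π : CuspidalAutomorphicRepData n F hcpt, π.1.IsLAlgebraic ∧ Corresponds Rec ι π.1 ρ := by
  constructor
  · rintro h F _ _ p _ ρ ⟨hF, hp, hsplit, hirr, hur, hpst, hres, hsign⟩
    exact h F hF p hp hsplit ρ hirr hur hpst hres hsign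
  · intro h F _ _ hF p _ hp hsplit ρ hirr hur hpst hres hsign
    exact h F p ρ ⟨hF, hp, hsplit, hirr, hur, hpst, hres, hsign⟩

/-- **`ρ` is potentially Qian-ordinary**: over some totally imaginary quadratic (CM) extension `K / F`,
`ρ|Γ_K` is potentially semistable ORDINARY with regular Hodge–Tate weights at every `w ∣ p` (for a
canonically normalised local Artin datum of `K_w`) and has a residual representation `ρ̄` with the
Taylor–Wiles hypotheses of Qian 2022 Thm. 1.4 (iii)–(iv): `ρ̄` absolutely irreducible and decomposed
generic, `ρ̄|Γ_{K(ζ_p)}` absolutely irreducible with enormous image, and a scalar `ρ̄(σ)` for some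
`σ ∉ Γ_{K(ζ_p)}`. [cite: Qian2022, Thm. 1.4 (hypotheses)] -/
def IsPotentiallyQianOrdinary {F : Type} [Field F] [NumberField F] {p : ℕ} [Fact p.Prime] {n : ℕ}
    (ρ : FramedGaloisRep F (PadicAlgCl p) n) : Prop :=
  ∃ (K : Type) (_ : Field K) (_ : NumberField K) (_ : Algebra F K),
    NumberField.IsCMField K ∧ Module.finrank F K = 2 ∧
    (∀ (w : HeightOneSpectrum (𝓞 K)), ((p : ℕ) : 𝓞 K) ∈ w.asIdeal →
      ∃ art : LocalArtinData (w.adicCompletion K), art.IsCanonical ∧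
        (ρ.restrictField K).IsOrdinaryRegularAt w art) ∧
    ∃ τ : absoluteGaloisGroup K →* GL (Fin n) (padicAlgClResidueField p),
      (ρ.restrictField K).IsResidualRepOf (RingHom.id _) τ ∧ IsAbsIrreducible τ ∧ IsDecomposedGeneric τ ∧
        IsAbsIrreducible (τ.comp (absGaloisGroupAdjoinRootsOfUnity K p).subtype) ∧
        Subgroup.IsEnormous ((absGaloisGroupAdjoinRootsOfUnity K p).map τ) ∧
        ∃ σ : absoluteGaloisGroup K, σ ∉ absGaloisGroupAdjoinRootsOfUnity K p ∧
          ∃ c : padicAlgClResidueField p,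
            ((τ σ : GL (Fin n) (padicAlgClResidueField p)) :
              Matrix (Fin n) (Fin n) (padicAlgClResidueField p)) = c • (1 : Matrix _ _ _)

/-- **CALIBRATION CELL (print-decided, size L): the potentially-Qian-ordinary scalar-sign regular `ρ` of
rank 3 are void.**  Chain: Qian 2022 Thm. 1.4 (`Qian2022.potentialAutomorphy_ordinary`, in tree; avoid the
field cut out by `ρ̄|Γ_{K(ζ_p)}`) gives a CM Galois `K′ ⊇ K` with `ρ|Γ_{K′} ≃ r_ι(Π′)`, `Π′` regular
algebraic cuspidal on `GL₃(𝔸_{K′})`; `ρ|Γ_{K′}` extends to `Γ_{K′⁺} ⊇ Γ_{K′}` (`K′⁺ ⊇ F` totally real), so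
`Π′ ≃ Π′ᶜ` (strong multiplicity one) descends (Arthur–Clozel Thm. III.4.2, `ArthurClozel1989_cuspidal_descent`)
to a regular algebraic cuspidal `π⁺` of `GL₃(𝔸_{K′⁺})`; HLTT (`exists_galoisRep_of_regularAlgebraic`)
and Chebotarev give `r_ι(π⁺) ≃ ρ|Γ_{K′⁺} ⊗ χ` with `χ² = 1`; Caraiani–Le Hung 2016 Thm. 1 (`n = 3` odd:
`tr r_ι(π⁺)(c) = ±1`) contradicts `tr = ±3`.  Conditional on vendoring Caraiani–Le Hung Thm. 1 (not in tree;
as printed it depends on Arthur's endoscopic classification — the descended `π⁺` is generically not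
essentially self-dual, so Taylor 2012 does not suffice).
[cite: Qian2022, Thm. 1.4] [cite: CaraianiLeHung2016, Thm. 1] [cite: ArthurClozel1989, Thm. III.4.2] -/
def OrdinaryScalarSignGL3 : Prop :=
  ∀ (F : Type) [Field F] [NumberField F] (p : ℕ) [Fact p.Prime]
    (ρ : FramedGaloisRep F (PadicAlgCl p) 3), InSector F p ρ → IsPotentiallyQianOrdinary ρ →
    ∀ (Rec : ReciprocityData F) (hcpt : isCompact_glFiniteIntegralLevel 3 F) (ι : PadicAlgCl p ≃+* ℂ),
      ∃ π : CuspidalAutomorphicRepData 3 F hcpt, π.1.IsLAlgebraic ∧ Corresponds Rec ι π.1 ρ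

/-- **THE OPEN CORE: the scalar-sign regular `ρ` of rank 3 that are NOT potentially Qian-ordinary**
(non-ordinary at some `w ∣ p` over every CM quadratic `K/F`, or with degenerate residual image there).
No engine in print: Calegari's self-dual shadow needs a Hodge–Tate-regular self-dual Schur functor of
`ρ`, and `SL₃` has none (Fulton–Harris Claim 13.4: every self-dual irreducible `SL₃`-module has a weight of
multiplicity ≥ 2); non-polarisable potential automorphy of a single `ρ` over CM fields is known only in
the ordinary case (Qian 2022 Thm. 1.4; ACC⁺ Thm. 6.1.1 is a LIFTING theorem).  Inside it, the twisted
essentially self-dual sub-cell `ρ ≃ ad⁰(σ) ⊗ μ` reduces to the floor for `σ` (rank 2) modulo the lift's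
local shape (3). [cite: Qian2022, Thm. 1.4] [cite: Calegari2011, §§3–4] -/
def NonOrdinaryScalarSignGL3 : Prop :=
  ∀ (F : Type) [Field F] [NumberField F] (p : ℕ) [Fact p.Prime]
    (ρ : FramedGaloisRep F (PadicAlgCl p) 3), InSector F p ρ → ¬ IsPotentiallyQianOrdinary ρ →
    ∀ (Rec : ReciprocityData F) (hcpt : isCompact_glFiniteIntegralLevel 3 F) (ι : PadicAlgCl p ≃+* ℂ),
      ∃ π : CuspidalAutomorphicRepData 3 F hcpt, π.1.IsLAlgebraic ∧ Corresponds Rec ι π.1 ρ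

/-- The rung from its two cells (case split on `IsPotentiallyQianOrdinary ρ`). -/
theorem rung_of_cells (hO : OrdinaryScalarSignGL3) (hN : NonOrdinaryScalarSignGL3) :
    ScalarSignRegularGL3 := by
  rw [ScalarSignRegularGL3, scalarSignRegularReciprocity_iff]
  intro F _ _ p _ ρ hsec Rec hcpt ι
  by_cases hq : IsPotentiallyQianOrdinary ρ
  · exact hO F p ρ hsec hq Rec hcpt ι
  · exact hN F p ρ hsec hq Rec hcpt ι

/-- The two cells from the rung (so rung ⟺ cells). -/
theorem cells_of_rung (h : ScalarSignRegularGL3) : OrdinaryScalarSignGL3 ∧ NonOrdinaryScalarSignGL3 := by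
  rw [ScalarSignRegularGL3, scalarSignRegularReciprocity_iff] at h
  exact ⟨fun F _ _ p _ ρ hsec _ Rec hcpt ι => h F p ρ hsec Rec hcpt ι,
    fun F _ _ p _ ρ hsec _ Rec hcpt ι => h F p ρ hsec Rec hcpt ι⟩

/-- **The further rungs** `n ≥ 4` of the family (gap item; at EVEN ranks `n = 2k` the self-dual shadow
`∧ᵏ ρ` is Hodge–Tate regular for generic weights and symmetric for even `k`, so Calegari's engine
re-engages modulo potential diagonalisability — recorded in LADDER, not claimed). -/
def HigherRanks : Prop := ∀ n : ℕ, 4 ≤ n → ScalarSignRegularReciprocity n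

/-- The whole positive-rank family from the floor fact, the two rank-3 cells and the higher rungs. -/
theorem family_of (hfloor : Calegari2011_thm_1_2) (hO : OrdinaryScalarSignGL3)
    (hN : NonOrdinaryScalarSignGL3) (hhigh : HigherRanks) :
    ∀ n : ℕ, 2 ≤ n → ScalarSignRegularReciprocity n := by
  intro n hn
  rcases Nat.lt_or_ge n 4 with h | h
  · interval_cases n
    · exact floor_two hfloor
    · exact rung_of_cells hO hN
  · exact hhigh n h

/-- **The scalar-sign sector of clause (B)** at `(F, ℓ, ρ)`: rank `≥ 2` and the family's hypotheses. -/
def InScalarSignSector (F : Type) [Field F] [NumberField F] (ℓ : ℕ) [Fact ℓ.Prime] {n : ℕ}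
    (ρ : FramedGaloisRep F (PadicAlgCl ℓ) n) : Prop :=
  2 ≤ n ∧ InSector F ℓ ρ

/-- **The off-sector complement**: E (`ReciprocityUpToIrreducibility`) with clause (A) entire and clause
(B) restricted to `ρ` NOT in the scalar-sign sector (gap item = the rest of E; it inherits the standing
disprover's §B–C finding `PinnedFontaineDatumUndecided` exactly as E does). -/
def OffSectorReciprocity : Prop :=
  ∀ (F : Type) [Field F] [NumberField F], ∃ Rec : ReciprocityData F, ∀ n : ℕ, 0 < n →
    ∀ hcpt : isCompact_glFiniteIntegralLevel n F,
      (∀ π : CuspidalAutomorphicRepData n F hcpt, π.1.IsLAlgebraic →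
        ∀ (ℓ : ℕ) [Fact ℓ.Prime] (ι : PadicAlgCl ℓ ≃+* ℂ),
          ∃ ρ : FramedGaloisRep F (PadicAlgCl ℓ) n, IsGeometricFramed Rec ρ ∧ Corresponds Rec ι π.1 ρ) ∧
      (∀ (ℓ : ℕ) [Fact ℓ.Prime] (ι : PadicAlgCl ℓ ≃+* ℂ) (ρ : FramedGaloisRep F (PadicAlgCl ℓ) n),
        ρ.toGaloisRep.IsIrreducible → IsGeometricFramed Rec ρ → ¬ InScalarSignSector F ℓ ρ →
          ∃ π : CuspidalAutomorphicRepData n F hcpt, π.1.IsLAlgebraic ∧ Corresponds Rec ι π.1 ρ)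

/-! ## 4. The five registered stubs -/

/-- The floor: Calegari 2011/2012 Thm. 1.2, a theorem in print vendored as a named fact (floor debt).
[cite: Calegari2011, Thm. 1.2] -/
theorem stub_floorFact : Calegari2011_thm_1_2 := by
  sorry

/-- **Calibration cell** (print-decided void, size L; see `OrdinaryScalarSignGL3`).
[cite: Qian2022, Thm. 1.4] [cite: CaraianiLeHung2016, Thm. 1] [cite: ArthurClozel1989, Thm. III.4.2] -/
theorem stub_ordinaryCell : OrdinaryScalarSignGL3 := by
  sorry

/-- **THE OPEN CORE / cap-lifting input** (see `NonOrdinaryScalarSignGL3`): a potential-automorphy (or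
direct parity) theorem for a single NON-ordinary non-polarisable regular `ρ : Γ_F → GL₃(ℚ̄_p)`. -/
theorem stub_nonOrdinaryCore : NonOrdinaryScalarSignGL3 := by
  sorry

/-- The rungs `n ≥ 4` of the family (open; gap item). -/
theorem stub_higherRanks : HigherRanks := by
  sorry

/-- The honest complement: E off the scalar-sign sector (gap item). -/
theorem stub_offSector : OffSectorReciprocity := by
  sorry

/-! ## 5. Composition (no sorry below this line) -/

/-- **COMPOSITION — the crux BY NAME from the five stub statements.**  `Rec` and clause (A) come from
the off-sector statement; clause (B) is a case split on the scalar-sign sector, where the family (for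
every `Rec`, in particular this one) applies. -/
theorem ReciprocityUpToIrreducibility_of :
    Calegari2011_thm_1_2 → OrdinaryScalarSignGL3 → NonOrdinaryScalarSignGL3 → HigherRanks →
    OffSectorReciprocity →
    Summit.Langlands.Langlands.Theses.OrdinaryPrimeTransport.ReciprocityUpToIrreducibility := by
  intro hfloor hO hN hhigh hoff F _ _
  obtain ⟨Rec, hall⟩ := hoff F
  refine ⟨Rec, fun n hn hcpt => ⟨(hall n hn hcpt).1, ?_⟩⟩
  intro ℓ _ ι ρ hirr hgeo
  by_cases hsec : InScalarSignSector F ℓ ρ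
  · obtain ⟨h2, hF, hp, hsplit, hirr', hur, hpst, hres, hsign⟩ := hsec
    exact family_of hfloor hO hN hhigh n h2 F hF ℓ hp hsplit ρ hirr' hur hpst hres hsign Rec hcpt ι
  · exact (hall n hn hcpt).2 ℓ ι ρ hirr hgeo hsec

/-- **THE REGISTERED SKELETON THEOREM** — the item's decl from the five registered stubs (audit:
proof-of-item modulo the five sorries). -/
theorem reciprocityUpToIrreducibility_holds :
    Summit.Langlands.Langlands.Theses.OrdinaryPrimeTransport.ReciprocityUpToIrreducibility :=
  ReciprocityUpToIrreducibility_of stub_floorFact stub_ordinaryCell stub_nonOrdinaryCore stub_higherRanks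
    stub_offSector

end Summit.Langlands.Langlands.Cruxes.ReciprocityUpToIrreducibility.ScalarSignRegularGL3

end
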